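import Mathlib
import HarnessLib
import Summits.AtomisticToContinuum.HydrodynamicLimit.Theorems.RelayRaceLocalityConeLocalisationLocalDefs
import Literature.Analysis.FunctionSpaces.FlatTorus

/-!
# RelayRaceLocality · ConeLocalisation — the comparison gases of the glue (`stub_comparison`)

Support file for the crux item `stmt-AtomisticToContinuum-12504` (`ConeLocalisation`, route
RelayRaceLocality of `AtomisticToContinuum/HydrodynamicLimit`), line `Sketch`
(zoomed-bubble-transplant), stub `stub_comparison` of the skeleton: the pure bookkeeping

`BubbleAtScale → FugacityStatics → FlatteningLinear → FlatteningDensity → PerCentreComparison`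

(all five `Prop`s are typed in `Theorems/RelayRaceLocalityConeLocalisationLocalDefs.lean`). No PDE and
no probability is proved here; the four hypotheses are assembled as follows (constants first, data
second):

* `ηP := min η₁ (min ηF 1)`; given the guard level `M`: `CF := CF(M, Cψ)`, slope
  `κ := max CF (Cψ M)`, bubble constants `s₀, ε₀, C` at level `M + 4`, comparison guard
  `M′ := 2M + Cκ + 4`, diameter ratio `Λ := 2M + 1`; given `δ₀`: the agreement radius `r` of
  `relayRaceLocality_exists_radius` (`r ≤ 1/16`, `κ r ≤ min δ₀ ε₀ ¼`, `Cκ r ≤ 1/(2M)`) and the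
  life span `Tc := r s₀`.
* Given the profile and the centre `c`: the cutoff `ψ` of `FlatteningLinear` at `(r, c)` and the
  `σ`-free comparison profile `a₂ = ψ a₀ + (1-ψ) a₀(c)`, `θ₂ = ψ θ₀ + (1-ψ) θ₀(c)`,
  `u₂ = ψ u₀ + (1-ψ) u₀(c)`; the threshold `σP := σS` of `FugacityStatics` with `K := 2M + 1`.
* Given `σ < σP` and tied smooth guarded data `(ρ₁, θ₁, u₁)`: `FugacityStatics` (1) identifies
  `u₁ = u₀`, `θ₁ = θ₀` and `a₀σ³ = e^{c₁}Ψ(ρ₁σ³)`; `FlatteningLinear` bounds `θ₂, u₂` at scale `r`;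
  `FlatteningDensity` produces `η₂` with `Ψ(η₂) = ψΨ(ρ₁σ³) + (1-ψ)Ψ(ρ₁(c)σ³)` and mass `s`;
  `σ₂ := s^{1/3}`, `ρ₂ := η₂/s` (unit mass, in `[½, 2]`); `BubbleAtScale` at diameter `σ₂` around the
  constant state `(ρ₁(c)σ³/s, θ₁(c), u₁(c))` gives the classical solution on `[0, Tc)`; the
  matched identity `a₂σ₂³ = e^{c₁ + log(s/σ³)}Ψ(ρ₂σ₂³)` (`relayRaceLocality_matched_identity`) feeds
  `FugacityStatics` (2), whose conclusion is the last conjunct of `PerCentreComparison` verbatim.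
-/

noncomputable section

namespace Summit.AtomisticToContinuum.HydrodynamicLimit.Theorems.ConeLocalisation

open scoped Topology
open Filter Set MeasureTheory
open Literature.MathematicalPhysics.KineticTheory Literature.Analysis.FluidPDE
  Literature.Analysis.FunctionSpaces
open Summit.AtomisticToContinuum.HydrodynamicLimit.Theses.RelayRaceLocality

/-- `ScaleDeviation` is monotone in the slope. [folklore] -/
theorem relayRaceLocality_scaleDeviation_mono {f : T3 → ℝ} {b r κ κ' : ℝ} (hr : 0 < r)
    (hκ : κ ≤ κ') (h : ScaleDeviation f b r κ) : ScaleDeviation f b r κ' := by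
  intro x
  obtain ⟨h0, hd⟩ := h x
  refine ⟨h0.trans (mul_le_mul_of_nonneg_right hκ hr.le), fun i j k => ?_⟩
  obtain ⟨h1, h2, h3⟩ := hd i j k
  exact ⟨h1.trans hκ, h2.trans (div_le_div_of_nonneg_right hκ hr.le),
    h3.trans (div_le_div_of_nonneg_right hκ (pow_pos hr 2).le)⟩

/-- `ScaleDeviationV` is monotone in the slope. [folklore] -/
theorem relayRaceLocality_scaleDeviationV_mono {w : T3 → V3} {b : V3} {r κ κ' : ℝ} (hr : 0 < r)
    (hκ : κ ≤ κ') (h : ScaleDeviationV w b r κ) : ScaleDeviationV w b r κ' := by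
  intro x
  obtain ⟨h0, hd⟩ := h x
  refine ⟨h0.trans (mul_le_mul_of_nonneg_right hκ hr.le), fun i j k => ?_⟩
  obtain ⟨h1, h2, h3⟩ := hd i j k
  exact ⟨h1.trans hκ, h2.trans (div_le_div_of_nonneg_right hκ hr.le),
    h3.trans (div_le_div_of_nonneg_right hκ (pow_pos hr 2).le)⟩

/-- `κ · (b / (κ + 1)) ≤ b` for `κ, b ≥ 0`. [folklore] -/
theorem relayRaceLocality_mul_div_succ_le {κ b : ℝ} (hκ : 0 ≤ κ) (hb : 0 ≤ b) :
    κ * (b / (κ + 1)) ≤ b := by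
  rw [mul_div_assoc', div_le_iff₀ (by positivity)]
  nlinarith

/-- **Choice of the agreement radius.** Given the slope `κ`, the bubble constant `C`, the guard
level `M`, the near-constancy target `δ₀` and the bubble smallness `ε₀`, there is a radius
`0 < r ≤ 1/16` with `κ r ≤ min δ₀ ε₀ (1/4)` and `C κ r ≤ 1/(2M)`. [folklore] -/
theorem relayRaceLocality_exists_radius {κ C M δ₀ ε₀ : ℝ} (hκ : 0 ≤ κ) (hC : 0 ≤ C) (hM : 0 < M)
    (hδ₀ : 0 < δ₀) (hε₀ : 0 < ε₀) :
    ∃ r : ℝ, 0 < r ∧ r ≤ 1 / 16 ∧ r ≤ 1 ∧ κ * r ≤ δ₀ ∧ κ * r ≤ ε₀ ∧ κ * r ≤ 1 / 4 ∧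
      C * κ * r ≤ 1 / (2 * M) := by
  set r : ℝ := min (1 / 16) (min (δ₀ / (κ + 1)) (min (ε₀ / (κ + 1)) (min (1 / (4 * κ + 4))
    (1 / (2 * M * (C * κ + 1) + 1))))) with hr
  have h1 : r ≤ 1 / 16 := min_le_left _ _
  have h2 : r ≤ δ₀ / (κ + 1) := (min_le_right _ _).trans (min_le_left _ _)
  have h3 : r ≤ ε₀ / (κ + 1) :=
    ((min_le_right _ _).trans (min_le_right _ _)).trans (min_le_left _ _)
  have h4 : r ≤ 1 / (4 * κ + 4) :=
    (((min_le_right _ _).trans (min_le_right _ _)).trans (min_le_right _ _)).trans (min_le_left _ _)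
  have h5 : r ≤ 1 / (2 * M * (C * κ + 1) + 1) :=
    (((min_le_right _ _).trans (min_le_right _ _)).trans (min_le_right _ _)).trans (min_le_right _ _)
  have hr0 : 0 < r := by positivity
  refine ⟨r, hr0, h1, h1.trans (by norm_num), ?_, ?_, ?_, ?_⟩
  · exact (mul_le_mul_of_nonneg_left h2 hκ).trans (relayRaceLocality_mul_div_succ_le hκ hδ₀.le)
  · exact (mul_le_mul_of_nonneg_left h3 hκ).trans (relayRaceLocality_mul_div_succ_le hκ hε₀.le)
  · refine (mul_le_mul_of_nonneg_left h4 hκ).trans ?_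
    rw [mul_one_div, div_le_div_iff₀ (by positivity) (by positivity)]
    nlinarith
  · refine (mul_le_mul_of_nonneg_left h5 (mul_nonneg hC hκ)).trans ?_
    rw [mul_one_div, div_le_div_iff₀ (by positivity) (by positivity)]
    nlinarith [mul_nonneg hC hκ]

/-- `σ₂³ ≤ Λσ³` with `Λ ≥ 1` gives `σ₂ ≤ Λσ`. [folklore] -/
theorem relayRaceLocality_le_mul_of_pow_three_le {σ₂ σ Λ : ℝ} (hσ : 0 ≤ σ) (hΛ : 1 ≤ Λ)
    (h : σ₂ ^ 3 ≤ Λ * σ ^ 3) : σ₂ ≤ Λ * σ := by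
  have hΛ3 : Λ ≤ Λ ^ 3 := le_self_pow₀ hΛ (by norm_num)
  have h' : σ₂ ^ 3 ≤ (Λ * σ) ^ 3 := by
    rw [mul_pow]
    exact h.trans (mul_le_mul_of_nonneg_right hΛ3 (by positivity))
  exact le_of_pow_le_pow_left₀ (by norm_num) (by positivity) h'

/-- The matched-activity algebra: from `aσ³ = eΨₓ` and `a_cσ³ = eΨ_c`,
`(ψ a + (1-ψ) a_c) s = e (s/σ³) (ψ Ψₓ + (1-ψ) Ψ_c)`. [folklore] -/
theorem relayRaceLocality_matched_identity {ψ a ac Ψx Ψc e s σ : ℝ} (hσ : 0 < σ)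
    (h1 : a * σ ^ 3 = e * Ψx) (h2 : ac * σ ^ 3 = e * Ψc) :
    (ψ * a + (1 - ψ) * ac) * s = e * (s / σ ^ 3) * (ψ * Ψx + (1 - ψ) * Ψc) := by
  have h1' : a = e * Ψx / σ ^ 3 := by rw [eq_div_iff (by positivity)]; exact h1
  have h2' : ac = e * Ψc / σ ^ 3 := by rw [eq_div_iff (by positivity)]; exact h2
  rw [h1', h2']
  ring

/-- Convex combinations of positive reals are positive. [folklore] -/
theorem relayRaceLocality_convex_pos {ψ a b : ℝ} (h0 : 0 ≤ ψ) (h1 : ψ ≤ 1) (ha : 0 < a)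
    (hb : 0 < b) : 0 < ψ * a + (1 - ψ) * b := by
  rcases h0.eq_or_lt with h | h
  · rw [← h]; simpa using hb
  · have : 0 ≤ (1 - ψ) * b := mul_nonneg (by linarith) hb.le
    nlinarith [mul_pos h ha]

/-- Smoothness of `η / s` from smoothness of `η`. [folklore] -/
theorem relayRaceLocality_isSmooth_div_const {η : T3 → ℝ} (hη : Torus.IsSmooth η) (s : ℝ) :
    Torus.IsSmooth (fun x => η x / s) := by
  have h := hη.smul s⁻¹
  convert h using 1
  funext x
  simp [div_eq_inv_mul]

/-- **Stub `stub_comparison` of line `Sketch` (zoomed-bubble-transplant): the comparison gases of the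
glue exist.** `BubbleAtScale → FugacityStatics → FlatteningLinear → FlatteningDensity →
PerCentreComparison` — flatten the tied data around the centre, normalise the flattened reduced
density, zoom the diameter to `σ₂ = (∫η₂)^{1/3}`, run the bubble at diameter `σ₂`, and read off the
law of large numbers of the matched comparison gas from the statics (see the module docstring for
the choice of constants). [folklore] -/
theorem stub_comparison :
    BubbleAtScale → FugacityStatics → FlatteningLinear → FlatteningDensity → PerCentreComparison := by
  intro hB hS hL hD
  unfold BubbleAtScale at hB
  unfold FugacityStatics at hS
  unfold FlatteningLinear at hL
  unfold FlatteningDensity at hD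
  unfold PerCentreComparison
  obtain ⟨η₁, hη₁, hB⟩ := hB
  obtain ⟨Cψ, hCψ, hL⟩ := hL
  obtain ⟨ηF, hηF, hD⟩ := hD
  refine ⟨min η₁ (min ηF 1), by positivity, fun M hM => ?_⟩
  -- constants depending on the guard level `M` only
  obtain ⟨CF, hCF, hD⟩ := hD M hM Cψ hCψ
  obtain ⟨s₀, hs₀, ε₀, hε₀, C, hC, hB⟩ := hB (M + 4) (by positivity)
  obtain ⟨κ, hκ⟩ : ∃ κ : ℝ, κ = max CF (Cψ * M) := ⟨_, rfl⟩
  have hCFκ : CF ≤ κ := by rw [hκ]; exact le_max_left _ _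
  have hCψκ : Cψ * M ≤ κ := by rw [hκ]; exact le_max_right _ _
  have hκ0 : 0 ≤ κ := hCF.le.trans hCFκ
  have hCκ0 : 0 ≤ C * κ := mul_nonneg hC.le hκ0
  have hM4 : M ≤ M + 4 := by linarith
  have hMinv : (M + 4)⁻¹ ≤ M⁻¹ := inv_anti₀ hM hM4
  have hM4inv : (M + 4)⁻¹ ≤ (4 : ℝ)⁻¹ := inv_anti₀ (by norm_num) (by linarith)
  refine ⟨2 * M + C * κ + 4, by linarith, 2 * M + 1, by linarith, fun δ₀ hδ₀ => ?_⟩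
  obtain ⟨r, hr, hr16, hr1, hκδ, hκε, hκ4, hCκr⟩ :=
    relayRaceLocality_exists_radius hκ0 hC.le hM hδ₀ hε₀
  refine ⟨r, hr, r * s₀, by positivity, ?_⟩
  intro a₀ θ₀ u₀ ha₀ hθ₀ hu₀ ha₀p hθ₀p c
  -- the cutoff at scale `r` around `c`
  obtain ⟨ψ, hψS, hψ01, hψ1, hψ0, hψD, hLM⟩ := hL r hr hr16 c
  obtain ⟨hLs, hLv⟩ := hLM M hM
  have hψc : Continuous ψ := hψS.continuous
  -- statics of the profile
  obtain ⟨ΛS, -, -, hSK⟩ := hS a₀ θ₀ u₀ ha₀ hθ₀ hu₀ ha₀p hθ₀p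
  obtain ⟨σS, hσS, hS1, hS2⟩ := hSK (2 * M + 1) (by linarith)
  -- the `σ`-free comparison profile
  obtain ⟨a₂, ha₂⟩ : ∃ a₂ : T3 → ℝ, a₂ = fun x => ψ x * a₀ x + (1 - ψ x) * a₀ c := ⟨_, rfl⟩
  obtain ⟨θ₂, hθ₂⟩ : ∃ θ₂ : T3 → ℝ, θ₂ = fun x => ψ x * θ₀ x + (1 - ψ x) * θ₀ c := ⟨_, rfl⟩
  obtain ⟨u₂, hu₂⟩ : ∃ u₂ : T3 → V3, u₂ = fun x => ψ x • u₀ x + (1 - ψ x) • u₀ c := ⟨_, rfl⟩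
  have ha₂x : ∀ x, a₂ x = ψ x * a₀ x + (1 - ψ x) * a₀ c := fun x => by rw [ha₂]
  have hθ₂x : ∀ x, θ₂ x = ψ x * θ₀ x + (1 - ψ x) * θ₀ c := fun x => by rw [hθ₂]
  have hu₂x : ∀ x, u₂ x = ψ x • u₀ x + (1 - ψ x) • u₀ c := fun x => by rw [hu₂]
  have ha₂pos : ∀ x, 0 < a₂ x := fun x => by
    rw [ha₂x x]; exact relayRaceLocality_convex_pos (hψ01 x).1 (hψ01 x).2 (ha₀p x) (ha₀p c)
  have hθ₂pos : ∀ x, 0 < θ₂ x := fun x => by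
    rw [hθ₂x x]; exact relayRaceLocality_convex_pos (hψ01 x).1 (hψ01 x).2 (hθ₀p x) (hθ₀p c)
  have ha₂c : Continuous a₂ := by
    rw [ha₂]; exact (hψc.mul ha₀).add ((continuous_const.sub hψc).mul continuous_const)
  have hθ₂c : Continuous θ₂ := by
    rw [hθ₂]; exact (hψc.mul hθ₀).add ((continuous_const.sub hψc).mul continuous_const)
  have hu₂c : Continuous u₂ := by
    rw [hu₂]; exact (hψc.smul hu₀).add ((continuous_const.sub hψc).smul continuous_const)
  refine ⟨a₂, θ₂, u₂, ha₂c, hθ₂c, hu₂c, ha₂pos, hθ₂pos, σS, hσS, ?_⟩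
  intro σ hσ hσσS ρ₁ θ₁ u₁ hρ₁S hθ₁S hu₁S hG Φ₁ hT
  -- (1) identification of the tied data: `u₁ = u₀`, `θ₁ = θ₀`, `a₀σ³ = e^{c₁}Ψ(ρ₁σ³)`
  obtain ⟨hu, hθ, -, -, c₁, hc₁⟩ :=
    hS1 σ hσ hσσS ρ₁ θ₁ u₁ hρ₁S.continuous hθ₁S.continuous hu₁S.continuous Φ₁ hT
  subst hu hθ
  -- the guards, repackaged for the three flattening statements
  have hGθ : ∀ x, |θ₁ x| ≤ M ∧ ∀ i j k : Fin 3, |Torus.partialDeriv i θ₁ x| ≤ M ∧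
      |Torus.partialDeriv i (Torus.partialDeriv j θ₁) x| ≤ M ∧
      |Torus.partialDeriv i (Torus.partialDeriv j (Torus.partialDeriv k θ₁)) x| ≤ M := fun x => by
    obtain ⟨-, -, -, h4, h5, -, h7⟩ := hG x
    refine ⟨abs_le.2 ⟨by linarith [inv_pos.2 hM], h5⟩, fun i j k => ?_⟩
    obtain ⟨-, -, hc, -, -, hf, -, -, hi⟩ := h7 i j k
    exact ⟨hc, hf, hi⟩
  have hGu : ∀ x, ‖u₁ x‖ ≤ M ∧ ∀ i j k : Fin 3, ‖Torus.partialDeriv i u₁ x‖ ≤ M ∧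
      ‖Torus.partialDeriv i (Torus.partialDeriv j u₁) x‖ ≤ M ∧
      ‖Torus.partialDeriv i (Torus.partialDeriv j (Torus.partialDeriv k u₁)) x‖ ≤ M := fun x => by
    obtain ⟨-, -, -, -, -, h6, h7⟩ := hG x
    refine ⟨h6, fun i j k => ?_⟩
    obtain ⟨-, hb, -, -, he, -, -, hh, -⟩ := h7 i j k
    exact ⟨hb, he, hh⟩
  have hGρ : ∀ x, ρ₁ x * σ ^ 3 ≤ ηF ∧ M⁻¹ ≤ ρ₁ x ∧ ρ₁ x ≤ M ∧ ∀ i j k : Fin 3,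
      |Torus.partialDeriv i ρ₁ x| ≤ M ∧ |Torus.partialDeriv i (Torus.partialDeriv j ρ₁) x| ≤ M ∧
      |Torus.partialDeriv i (Torus.partialDeriv j (Torus.partialDeriv k ρ₁)) x| ≤ M := fun x => by
    obtain ⟨h1, h2, h3, -, -, -, h7⟩ := hG x
    refine ⟨(h1.trans (min_le_right _ _)).trans (min_le_left _ _), h2, h3, fun i j k => ?_⟩
    obtain ⟨ha, -, -, hd, -, -, hg, -, -⟩ := h7 i j k
    exact ⟨ha, hd, hg⟩
  -- (2) the linear flattening of `θ₁` and `u₁`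
  obtain ⟨hθ₂S, hθ₂in, hθ₂out, hθ₂D⟩ := hLs θ₁ hθ₁S hGθ
  obtain ⟨hu₂S, hu₂in, hu₂out, hu₂D⟩ := hLv u₁ hu₁S hGu
  have hθ₂S' : Torus.IsSmooth θ₂ := by rw [hθ₂]; exact hθ₂S
  have hu₂S' : Torus.IsSmooth u₂ := by rw [hu₂]; exact hu₂S
  have hθ₂D' : ScaleDeviation θ₂ (θ₁ c) r κ := by
    rw [hθ₂]; exact relayRaceLocality_scaleDeviation_mono hr hCψκ hθ₂D
  have hu₂D' : ScaleDeviationV u₂ (u₁ c) r κ := by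
    rw [hu₂]; exact relayRaceLocality_scaleDeviationV_mono hr hCψκ hu₂D
  -- (3) the nonlinear flattening of the reduced density
  obtain ⟨η₂, hη₂S, -, hη₂Ψ, hη₂in, hη₂out, hslo, hshi, hosc, hoscc, hSD⟩ :=
    hD r hr hr16 c ψ hψS hψ01 hψ1 hψ0 hψD σ hσ ρ₁ hρ₁S hGρ
  obtain ⟨s, hs⟩ : ∃ s : ℝ, (∫ x, η₂ x) = s := ⟨_, rfl⟩
  rw [hs] at hslo hshi hosc hoscc hSD
  have hσ3 : 0 < σ ^ 3 := pow_pos hσ 3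
  have hspos : 0 < s := lt_of_lt_of_le (by positivity) hslo
  have hκr4 : CF * r ≤ 1 / 4 := (mul_le_mul_of_nonneg_right hCFκ hr.le).trans hκ4
  have hκrδ : CF * r ≤ δ₀ := (mul_le_mul_of_nonneg_right hCFκ hr.le).trans hκδ
  -- (4) the zoomed diameter `σ₂ = s^{1/3}` and the normalised density `ρ₂ = η₂ / s`
  obtain ⟨σ₂, hσ₂, hσ₂3⟩ : ∃ σ₂ : ℝ, 0 < σ₂ ∧ σ₂ ^ 3 = s :=
    ⟨s ^ (1 / 3 : ℝ), Real.rpow_pos_of_pos hspos _, by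
      rw [← Real.rpow_natCast (s ^ (1 / 3 : ℝ)) 3, ← Real.rpow_mul hspos.le]; norm_num⟩
  have hK : σ₂ ^ 3 ≤ (2 * M + 1) * σ ^ 3 := by rw [hσ₂3]; nlinarith
  have hσ₂Λ : σ₂ ≤ (2 * M + 1) * σ :=
    relayRaceLocality_le_mul_of_pow_three_le hσ.le (by linarith) hK
  obtain ⟨ρ₂, hρ₂⟩ : ∃ ρ₂ : T3 → ℝ, ρ₂ = fun x => η₂ x / s := ⟨_, rfl⟩
  have hρ₂x : ∀ x, ρ₂ x = η₂ x / s := fun x => by rw [hρ₂]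
  have hρ₂D : ScaleDeviation ρ₂ (ρ₁ c * σ ^ 3 / s) r κ := by
    rw [hρ₂]; exact relayRaceLocality_scaleDeviation_mono hr hCFκ hSD
  have hρ₂S : Torus.IsSmooth ρ₂ := by
    rw [hρ₂]; exact relayRaceLocality_isSmooth_div_const hη₂S s
  have hρ₂band : ∀ x, 2⁻¹ ≤ ρ₂ x ∧ ρ₂ x ≤ 2 := fun x => by
    obtain ⟨h1, h2⟩ := abs_le.1 (hosc x)
    rw [hρ₂x x]
    constructor <;> linarith
  have hρ₂mass : (∫ x, ρ₂ x) = 1 := by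
    rw [hρ₂]; exact (integral_div s η₂).trans (by rw [hs, div_self hspos.ne'])
  have hident : ∀ x, a₂ x * σ₂ ^ 3 =
      Real.exp (c₁ + Real.log (s / σ ^ 3)) * hsActivity (ρ₂ x * σ₂ ^ 3) := fun x => by
    rw [ha₂x x, hρ₂x x, hσ₂3, div_mul_cancel₀ (η₂ x) hspos.ne', hη₂Ψ x, Real.exp_add,
      Real.exp_log (div_pos hspos hσ3)]
    exact relayRaceLocality_matched_identity hσ (hc₁ x) (hc₁ c)
  -- the constant state `(ρ₁(c)σ³/s, θ₁(c), u₁(c))` of the bubble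
  obtain ⟨hblo, hbhi⟩ := abs_le.1 hoscc
  have hfar : ∀ x, 2 * r ≤ Torus.euclidDist x c →
      ρ₂ x = ρ₁ c * σ ^ 3 / s ∧ θ₂ x = θ₁ c ∧ u₂ x = u₁ c := fun x hx =>
    ⟨by rw [hρ₂x x, hη₂out x hx], by rw [hθ₂x x]; exact hθ₂out x hx,
      by rw [hu₂x x]; exact hu₂out x hx⟩
  obtain ⟨hpack, -, -, hθlo, hθhi, hun, -⟩ := hG c
  -- (5) the bubble at diameter `σ₂`, scale `r`, slope `κ`
  obtain ⟨R, Θ, U, hsol, hR0, hΘ0, hU0, hdev, -⟩ := hB σ₂ hσ₂ (ρ₁ c * σ ^ 3 / s) (θ₁ c) (u₁ c)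
    (by linarith) (by linarith)
    (by rw [hσ₂3, div_mul_cancel₀ _ hspos.ne']; exact hpack.trans (min_le_left _ _))
    (hMinv.trans hθlo) (hθhi.trans hM4) (hun.trans hM4) r κ hr hr16 hκ0 hκε c ρ₂ θ₂ u₂
    hρ₂S hθ₂S' hu₂S' hfar hρ₂D hθ₂D' hu₂D'
  subst hR0 hΘ0 hU0
  refine ⟨σ₂, hσ₂, hσ₂Λ, R, Θ, U, hsol, fun x hx => ⟨?_, ?_, ?_⟩,
    ⟨u₁ c, θ₁ c, fun x => ⟨?_, ?_, ?_⟩⟩, fun t ht x => ?_, ?_⟩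
  · -- (6) agreement on `B(c, r)`
    rw [hρ₂x x, hσ₂3, div_mul_cancel₀ _ hspos.ne', hη₂in x hx]
  · rw [hu₂x x]; exact (hu₂in x hx).symm
  · rw [hθ₂x x]; exact (hθ₂in x hx).symm
  · -- near-constancy at time `0`
    rw [hρ₂x x]; exact (hosc x).trans hκrδ
  · exact (hu₂D' x).1.trans hκδ
  · exact (hθ₂D' x).1.trans hκδ
  · -- the `C¹` guards `M′ = 2M + Cκ + 4` on `[0, Tc)`
    obtain ⟨hRt, hΘt, hUt, hDt⟩ := hdev t ht x
    obtain ⟨-, hR2⟩ := abs_le.1 hRt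
    obtain ⟨hΘ1, hΘ2⟩ := abs_le.1 hΘt
    have hCκr' : C * κ * r ≤ C * κ := mul_le_of_le_one_right hCκ0 hr1
    have h1 : (2 * M + C * κ + 4)⁻¹ ≤ 1 / (2 * M) := by
      rw [inv_eq_one_div]; exact one_div_le_one_div_of_le (by positivity) (by linarith)
    have h2 : (1 : ℝ) / (2 * M) = M⁻¹ / 2 := by rw [one_div, mul_inv]; ring
    refine ⟨by linarith, by linarith, by linarith, ?_, fun i => ?_⟩
    · calc ‖U t x‖ = ‖(U t x - u₁ c) + u₁ c‖ := by rw [sub_add_cancel]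
        _ ≤ ‖U t x - u₁ c‖ + ‖u₁ c‖ := norm_add_le _ _
        _ ≤ C * κ * r + M := add_le_add hUt hun
        _ ≤ 2 * M + C * κ + 4 := by linarith
    · obtain ⟨hd1, hd2, hd3⟩ := hDt i
      exact ⟨hd1.trans (by linarith), hd2.trans (by linarith), hd3.trans (by linarith)⟩
  · -- (7) probability and time-`0` LLN of the matched comparison gas
    exact hS2 σ hσ hσσS σ₂ hσ₂ hK a₂ (Θ 0) (R 0) (U 0) hθ₂S'.continuous hu₂S'.continuous
      hρ₂S.continuous hθ₂pos hρ₂band hρ₂mass (c₁ + Real.log (s / σ ^ 3)) hident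

end Summit.AtomisticToContinuum.HydrodynamicLimit.Theorems.ConeLocalisation

end
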